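import Summits.Ventures.PercRepro.ProfileGapMonoThresholdDeletionCount

/-!
# PercRepro — THE WEAK AVERAGED STEP IS A THEOREM AT `(q, t) = (2, 3)` ON EVERY SIMPLE MATROID
(p5, gen 27; `proofs/P5-GM1.md` §26; announced on the bus before typing)

The first PROVED instance of the weak averaged deletion step `Σ_{z ∈ E} Φ_3(N ∖ z) ≤ #E · Φ_3(N)` of the threshold
gap `Φ_3(N) = 2 · #{S : ρ(S) = 2, ρ(E∖S) ≥ 3} − Σ_{b : ρ(E∖b) ≥ 4} ρ(E∖b)` (`WeakAvgStepT α 2 3`, the conjecture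
def of `ProfileGapMonoThresholdWeakAverage`): it holds on every SIMPLE finite matroid (no loop, no parallel pair),
of every rank, coloops allowed.  The proof is one charging, in three lines.  Write `n = #E`, `m'_b = ρ(E∖b)`,
`κ_b = #coloops(E∖b)`, `T = {S : ρ(S) = 2, ρ(E∖S) ≥ 3}`.  The deletion bookkeeping of
`ProfileGapMonoThresholdDeletionCount` reduces the step to
`Σ_{b : m'_b ≥ 5} (m'_b + κ_b) + Σ_{b : m'_b = 4} 4 (1 + κ_b) ≤ 2 Σ_{S ∈ T} #S + 2 Σ_{S ∈ T, ρ(E∖S) = 3} κ(E∖S)`.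
* (A) the pairs `(b, y)` with `ρ(E∖b) ≥ 4`, `y ≠ b`, map at most two-to-one into `T` (`{b, y}` has rank `2` and
  co-rank `≥ 3`), so `Σ_b 2 (n − 1) ≤ 4 #T ≤ 2 Σ_{S ∈ T} #S` (`card_filter_mul_le_two_mul_card_levelSetCoQ`);
* (B) for `m'_b = 4` and a coloop `y` of `E ∖ b`, `{b, y} ∈ T` has co-rank exactly `3` and every other coloop `w` of
  `E ∖ b` is a coloop of `E ∖ {b, y}` (submodularity: `ρ(E∖{b,y}) + ρ(E∖{b,w}) ≥ ρ(E∖b) + ρ(E∖{b,y,w})` forces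
  `ρ(E∖{b,y,w}) = 2`), so `Σ_{b : m'_b = 4} κ_b (κ_b − 1) ≤ 2 Σ_{S ∈ T, ρ(E∖S) = 3} κ(E∖S)`
  (`death_of_coloop`, `sum_card_coloops_mul_pred_le`);
* (C) per point: `m'_b + κ_b ≤ 2 (n − 1)` when `m'_b ≥ 5` (both are `≤ #(E∖b)`), and
  `4 + 4 κ_b ≤ 2 (n − 1) + κ_b (κ_b − 1)` when `m'_b = 4` (`n ≥ 5`; a rank-`4` set of `4` elements is all coloops, so
  `κ_b ∈ {2, 3}` forces `#(E∖b) ≥ 5`) — `weakAvg_point_arith`.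
The three are exact on the tight instances (free matroids, `U_{4,5}`, `U_{2,3} ⊕ U_{2,3}`).  No rank case split:
the finite case analysis at `ρ(E) = 4` of §25(t) is not needed.  Nothing here asserts `WeakAvgStepT` itself (loops
and parallel points are outside the statement; parallel pairs are open).

* `rk_pair_eq_two_of_simple`, `sdiff_insert_singleton_eq_erase`, `card_filter_mul_le_two_mul_card_levelSetCoQ`,
  `death_of_coloop`, `sum_card_coloops_mul_pred_le`, `weakAvg_point_arith`,
  **`weakAvg_two_three_of_simple`**, `exists_delMonoT_two_three_of_simple`.
-/

open scoped Matroid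

namespace PercRepro.Cogirth

open Finset ThmH Skew Shadow Profile

variable {α : Type} [DecidableEq α] {M : Matroid α} [M.Finite]

section Simple

variable {N : Matroid α} [N.Finite]

/-- In a simple matroid two distinct points form a rank-`2` set. -/
theorem rk_pair_eq_two_of_simple (hloop : ∀ x ∈ gr N, rk N {x} = 1)
    (hpar : ∀ x ∈ gr N, ∀ y ∈ gr N, x ≠ y → rk N {x, y} ≠ 1) {y b : α} (hy : y ∈ gr N) (hb : b ∈ gr N)
    (hyb : y ≠ b) : rk N {y, b} = 2 := by
  have hne : rk N {y, b} ≠ 1 := hpar y hy b hb hyb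
  have hle : rk N {y, b} ≤ 2 := by
    have h := rk_le_card (M := N) ({y, b} : Finset α)
    have hc : ({y, b} : Finset α).card ≤ 2 := card_le_two
    omega
  have hge : 1 ≤ rk N {y, b} := by
    have h := rk_mono' (M := N) (show ({b} : Finset α) ⊆ {y, b} by simp)
    rw [hloop b hb] at h
    exact h
  omega

/-- `E ∖ {y, b} = (E ∖ b) ∖ y`. -/
theorem sdiff_insert_singleton_eq_erase (y b : α) :
    gr N \ insert y {b} = (gr N \ {b}).erase y := by
  ext x
  simp only [mem_sdiff, mem_insert, mem_singleton, mem_erase, not_or]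
  tauto

/-- **(A) The pairs are at most two-to-one**: on a simple matroid,
`#{b : ρ(E∖b) ≥ t+1} · (n − 1) ≤ 2 · #{S : ρ(S) = 2, ρ(E∖S) ≥ t}` — the map `(b, y) ↦ {b, y}` from the
`#L_t · (n − 1)` pairs into `T_t` (the count of `thresholdIneq_two_of_simple` with the weight `n − 1`). -/
theorem card_filter_mul_le_two_mul_card_levelSetCoQ (hloop : ∀ x ∈ gr N, rk N {x} = 1)
    (hpar : ∀ x ∈ gr N, ∀ y ∈ gr N, x ≠ y → rk N {x, y} ≠ 1) (t : ℕ) :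
    ((Rq N (2 - 1)).filter (fun B => t + 1 ≤ rk N (gr N \ B))).card * ((gr N).card - 1) ≤
      2 * (levelSetCoQ N t 2).card := by
  set L := (Rq N (2 - 1)).filter (fun B => t + 1 ≤ rk N (gr N \ B)) with hL
  set P := L.sigma (fun B => gr N \ B) with hP
  have h1 : P.card = L.card * ((gr N).card - 1) := by
    rw [hP, card_sigma]
    trans ∑ _B ∈ L, ((gr N).card - 1)
    · refine sum_congr rfl (fun B hB => ?_)
      rw [hL, mem_filter] at hB
      obtain ⟨b, hb, rfl⟩ := eq_singleton_of_mem_Rq_one hloop hpar hB.1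
      rw [card_sdiff_of_subset (singleton_subset_iff.2 hb), card_singleton]
    · rw [sum_const, smul_eq_mul]
  have h2 : P.card ≤ 2 * (levelSetCoQ N t 2).card := by
    apply card_le_mul_card_image_of_maps_to (f := fun p : (Σ _ : Finset α, α) => insert p.2 p.1)
    · rintro ⟨B, y⟩ hp
      rw [hP, mem_sigma] at hp
      obtain ⟨hBL, hy⟩ := hp
      rw [hL, mem_filter] at hBL
      obtain ⟨hB, hBt⟩ := hBL
      obtain ⟨b, hb, rfl⟩ := eq_singleton_of_mem_Rq_one hloop hpar hB
      rw [mem_sdiff, mem_singleton] at hy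
      obtain ⟨hyg, hyb⟩ := hy
      rw [mem_levelSetCoQ]
      refine ⟨⟨insert_subset hyg (singleton_subset_iff.2 hb), ?_⟩, ?_⟩
      · exact eRk_eq_of_rk_eq_cq (rk_pair_eq_two_of_simple hloop hpar hyg hb hyb)
      · have hyB : y ∈ gr N \ {b} := mem_sdiff.2 ⟨hyg, by rwa [mem_singleton]⟩
        have h3 := rk_le_rk_erase_add_one (M := N) (X := gr N \ {b}) sdiff_subset hyB
        simp only at hBt
        show t ≤ rk N (gr N \ insert y {b})
        rw [sdiff_insert_singleton_eq_erase]
        omega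
    · intro S _
      rcases (P.filter (fun p : (Σ _ : Finset α, α) => insert p.2 p.1 = S)).eq_empty_or_nonempty with
        hemp | ⟨⟨B₀, y₀⟩, hp₀⟩
      · rw [hemp, card_empty]
        exact Nat.zero_le _
      · rw [mem_filter] at hp₀
        obtain ⟨hp₀, hS₀⟩ := hp₀
        rw [hP, mem_sigma] at hp₀
        rw [hL, mem_filter] at hp₀
        obtain ⟨b₀, _, rfl⟩ := eq_singleton_of_mem_Rq_one hloop hpar hp₀.1.1
        have hScard : S.card ≤ 2 := by
          simp only at hS₀
          rw [← hS₀]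
          have h := card_insert_le y₀ ({b₀} : Finset α)
          rw [card_singleton] at h
          exact h
        refine le_trans (card_le_card_of_injOn (fun p : (Σ _ : Finset α, α) => p.2) ?_ ?_) hScard
        · intro p hp
          rw [mem_coe, mem_filter] at hp
          rw [mem_coe, ← hp.2]
          exact mem_insert_self _ _
        · rintro ⟨B₁, y₁⟩ hp₁ ⟨B₂, y₂⟩ hp₂ heq
          simp only at heq
          subst heq
          rw [mem_coe, mem_filter, hP, mem_sigma] at hp₁ hp₂
          have hy₁ : y₁ ∉ B₁ := fun h => (mem_sdiff.1 hp₁.1.2).2 h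
          have hy₂ : y₁ ∉ B₂ := fun h => (mem_sdiff.1 hp₂.1.2).2 h
          have hB : B₁ = B₂ := by
            have e₁ : B₁ = (insert y₁ B₁).erase y₁ := (erase_insert hy₁).symm
            have e₂ : B₂ = (insert y₁ B₂).erase y₁ := (erase_insert hy₂).symm
            simp only at hp₁ hp₂
            rw [e₁, e₂, hp₁.2, hp₂.2]
          subst hB
          rfl
  rw [← h1]
  exact h2

/-- **(B) The coloop deaths, by submodularity**: for `b` with `ρ(E∖b) = 4` and a coloop `y` of `E ∖ b`, the pair
`{b, y}` is a rank-`2` set of co-rank exactly `3`, and every other coloop `w` of `E ∖ b` is a coloop of `E ∖ {b, y}`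
(`ρ(E∖{b,y}) + ρ(E∖{b,w}) ≥ ρ(E∖b) + ρ(E∖{b,y,w})`). -/
theorem death_of_coloop (hloop : ∀ x ∈ gr N, rk N {x} = 1)
    (hpar : ∀ x ∈ gr N, ∀ y ∈ gr N, x ≠ y → rk N {x, y} ≠ 1) {b y : α} (hb : b ∈ gr N)
    (h4 : rk N (gr N \ {b}) = 4) (hy : y ∈ coloops N (gr N \ {b})) :
    insert y {b} ∈ (levelSetCoQ N 3 2).filter (fun S => rk N (gr N \ S) = 3) ∧
      (coloops N (gr N \ {b})).card - 1 ≤ (coloops N (gr N \ insert y {b})).card := by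
  set X := gr N \ {b} with hXdef
  have hX : X ⊆ gr N := sdiff_subset
  have hyX : y ∈ X := coloops_subset X hy
  have hyg : y ∈ gr N := hX hyX
  have hyb : y ≠ b := by
    intro h
    rw [hXdef, mem_sdiff, mem_singleton] at hyX
    exact hyX.2 h
  have hry : rk N (X.erase y) + 1 = rk N X := rk_erase_of_mem_coloops hX hy
  have hsd : gr N \ insert y {b} = X.erase y := sdiff_insert_singleton_eq_erase y b
  refine ⟨?_, ?_⟩
  · rw [mem_filter, mem_levelSetCoQ, hsd]
    refine ⟨⟨⟨insert_subset hyg (singleton_subset_iff.2 hb), ?_⟩, by omega⟩, by omega⟩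
    exact eRk_eq_of_rk_eq_cq (rk_pair_eq_two_of_simple hloop hpar hyg hb hyb)
  · rw [hsd, ← card_erase_of_mem hy]
    apply card_le_card
    intro w hw
    rw [mem_erase] at hw
    obtain ⟨hwy, hw⟩ := hw
    have hwX : w ∈ X := coloops_subset X hw
    have hrw : rk N (X.erase w) + 1 = rk N X := rk_erase_of_mem_coloops hX hw
    have hwXy : w ∈ X.erase y := mem_erase.2 ⟨hwy, hwX⟩
    apply mem_coloops_of_rk_erase ((erase_subset _ _).trans hX) hwXy
    -- submodularity on `X ∖ y` and `X ∖ w`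
    have hU : X.erase y ∪ X.erase w = X := by
      ext x
      simp only [mem_union, mem_erase]
      constructor
      · rintro (⟨_, h⟩ | ⟨_, h⟩) <;> exact h
      · intro hx
        by_cases hxy : x = y
        · exact Or.inr ⟨by rw [hxy]; exact fun h => hwy h.symm, hx⟩
        · exact Or.inl ⟨hxy, hx⟩
    have hI : X.erase y ∩ X.erase w = (X.erase y).erase w := by
      ext x
      simp only [mem_inter, mem_erase]
      tauto
    have hsub := rk_union_add_rk_inter_le (M := N) (X.erase y) (X.erase w)
    rw [hU, hI] at hsub
    have hlo := rk_le_rk_erase_add_one (M := N) (X := X.erase y) ((erase_subset _ _).trans hX) hwXy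
    omega

/-- **(B) summed**: `Σ_{b : ρ(E∖b) = 4} κ_b (κ_b − 1) ≤ 2 · Σ_{S ∈ T, ρ(E∖S) = 3} #coloops(E∖S)`. -/
theorem sum_card_coloops_mul_pred_le (hloop : ∀ x ∈ gr N, rk N {x} = 1)
    (hpar : ∀ x ∈ gr N, ∀ y ∈ gr N, x ≠ y → rk N {x, y} ≠ 1) :
    ∑ B ∈ (Rq N (2 - 1)).filter (fun B => rk N (gr N \ B) = 4),
        (coloops N (gr N \ B)).card * ((coloops N (gr N \ B)).card - 1) ≤
      2 * ∑ S ∈ (levelSetCoQ N 3 2).filter (fun S => rk N (gr N \ S) = 3), (coloops N (gr N \ S)).card := by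
  set L4 := (Rq N (2 - 1)).filter (fun B => rk N (gr N \ B) = 4) with hL4
  set D := (levelSetCoQ N 3 2).filter (fun S => rk N (gr N \ S) = 3) with hD
  set Q := L4.sigma (fun B => coloops N (gr N \ B)) with hQ
  -- the key facts for every pair `(B, y) ∈ Q`
  have hkey : ∀ p ∈ Q, insert p.2 p.1 ∈ D ∧
      (coloops N (gr N \ p.1)).card - 1 ≤ (coloops N (gr N \ insert p.2 p.1)).card := by
    rintro ⟨B, y⟩ hp
    rw [hQ, mem_sigma] at hp
    obtain ⟨hB, hy⟩ := hp
    rw [hL4, mem_filter] at hB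
    obtain ⟨hB, h4⟩ := hB
    obtain ⟨b, hb, rfl⟩ := eq_singleton_of_mem_Rq_one hloop hpar hB
    exact death_of_coloop hloop hpar hb h4 hy
  -- the left side is the sum over `Q` of `κ − 1`
  have h1 : ∑ B ∈ L4, (coloops N (gr N \ B)).card * ((coloops N (gr N \ B)).card - 1) =
      ∑ p ∈ Q, ((coloops N (gr N \ p.1)).card - 1) := by
    rw [hQ, sum_sigma]
    refine sum_congr rfl (fun B _ => ?_)
    show _ = ∑ _s ∈ coloops N (gr N \ B), ((coloops N (gr N \ B)).card - 1)
    rw [sum_const, smul_eq_mul]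
  rw [h1]
  calc ∑ p ∈ Q, ((coloops N (gr N \ p.1)).card - 1)
      ≤ ∑ p ∈ Q, (coloops N (gr N \ insert p.2 p.1)).card := sum_le_sum (fun p hp => (hkey p hp).2)
    _ = ∑ S ∈ D, ∑ p ∈ Q.filter (fun p : (Σ _ : Finset α, α) => insert p.2 p.1 = S),
          (coloops N (gr N \ insert p.2 p.1)).card :=
        (sum_fiberwise_of_maps_to (fun p hp => (hkey p hp).1) _).symm
    _ ≤ ∑ S ∈ D, 2 * (coloops N (gr N \ S)).card := by
        apply sum_le_sum
        intro S _
        rw [sum_congr rfl (fun p hp => by rw [(mem_filter.1 hp).2]), sum_const, smul_eq_mul]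
        apply Nat.mul_le_mul_right
        -- every fibre has at most two elements
        rcases (Q.filter (fun p : (Σ _ : Finset α, α) => insert p.2 p.1 = S)).eq_empty_or_nonempty with
          hemp | ⟨⟨B₀, y₀⟩, hp₀⟩
        · rw [hemp, card_empty]
          exact Nat.zero_le _
        · rw [mem_filter] at hp₀
          obtain ⟨hp₀, hS₀⟩ := hp₀
          rw [hQ, mem_sigma] at hp₀
          rw [hL4, mem_filter] at hp₀
          obtain ⟨b₀, _, rfl⟩ := eq_singleton_of_mem_Rq_one hloop hpar hp₀.1.1
          have hScard : S.card ≤ 2 := by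
            simp only at hS₀
            rw [← hS₀]
            have h := card_insert_le y₀ ({b₀} : Finset α)
            rw [card_singleton] at h
            exact h
          refine le_trans (card_le_card_of_injOn (fun p : (Σ _ : Finset α, α) => p.2) ?_ ?_) hScard
          · intro p hp
            rw [mem_coe, mem_filter] at hp
            rw [mem_coe, ← hp.2]
            exact mem_insert_self _ _
          · rintro ⟨B₁, y₁⟩ hp₁ ⟨B₂, y₂⟩ hp₂ heq
            simp only at heq
            subst heq
            rw [mem_coe, mem_filter, hQ, mem_sigma] at hp₁ hp₂
            have hy₁ : y₁ ∉ B₁ := fun h => (mem_sdiff.1 (coloops_subset _ hp₁.1.2)).2 h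
            have hy₂ : y₁ ∉ B₂ := fun h => (mem_sdiff.1 (coloops_subset _ hp₂.1.2)).2 h
            have hB : B₁ = B₂ := by
              have e₁ : B₁ = (insert y₁ B₁).erase y₁ := (erase_insert hy₁).symm
              have e₂ : B₂ = (insert y₁ B₂).erase y₁ := (erase_insert hy₂).symm
              simp only at hp₁ hp₂
              rw [e₁, e₂, hp₁.2, hp₂.2]
            subst hB
            rfl
    _ = 2 * ∑ S ∈ D, (coloops N (gr N \ S)).card := by rw [mul_sum]

end Simple

section Main

variable {N : Matroid α} [N.Finite]

/-- **(C) The per-point arithmetic** (`x = #(E∖b)`, `m = ρ(E∖b)`, `k = #coloops(E∖b)`): the point's demand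
`(x + 1) · [4 ≤ m] m` is paid by its own deletion terms `(x − k) · [4 ≤ m] m + k · [4 ≤ m − 1] (m − 1)` plus its share
`[4 ≤ m] · 2x` of the pairs and, at `m = 4`, its share `k (k − 1)` of the coloop deaths; at `m = 4` a rank-`4`
set of `4` elements is all coloops (`k = 4`), otherwise `x ≥ 5`. -/
theorem weakAvg_point_arith (x m k : ℕ) (hmx : m ≤ x) (hkx : k ≤ x) (h4 : m = 4 → k = 4 ∨ 5 ≤ x) :
    (x + 1) * (if 3 + 1 ≤ m then m else 0) ≤
      ((x - k) * (if 3 + 1 ≤ m then m else 0) + k * (if 3 + 1 ≤ m - 1 then m - 1 else 0)) +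
        ((if 3 + 1 ≤ m then 2 * x else 0) + (if m = 4 then k * (k - 1) else 0)) := by
  by_cases h5 : 5 ≤ m
  · have hA : 3 + 1 ≤ m := by omega
    have hB : 3 + 1 ≤ m - 1 := by omega
    have hC : m ≠ 4 := by omega
    simp only [if_pos hA, if_pos hB, if_neg hC]
    obtain ⟨d, rfl⟩ : ∃ d, x = k + d := ⟨x - k, by omega⟩
    obtain ⟨e, rfl⟩ : ∃ e, m = e + 1 := ⟨m - 1, by omega⟩
    rw [Nat.add_sub_cancel_left, Nat.add_sub_cancel]
    nlinarith [hmx, hkx]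
  · by_cases hm : m = 4
    · subst hm
      simp only [if_pos (by norm_num : (3 : ℕ) + 1 ≤ 4), if_neg (by norm_num : ¬ ((3 : ℕ) + 1 ≤ 4 - 1)),
        if_true]
      rcases h4 rfl with rfl | hx5
      · omega
      · by_cases hk : k ≤ 4
        · interval_cases k <;> omega
        · obtain ⟨d, rfl⟩ : ∃ d, x = k + d := ⟨x - k, by omega⟩
          obtain ⟨e, rfl⟩ : ∃ e, k = e + 1 := ⟨k - 1, by omega⟩
          rw [Nat.add_sub_cancel_left, Nat.add_sub_cancel]
          nlinarith [hk]
    · have hA : ¬ (3 + 1 ≤ m) := by omega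
      have hB : ¬ (3 + 1 ≤ m - 1) := by omega
      simp only [if_neg hA, if_neg hB, if_neg hm]
      omega

/-- **THE WEAK AVERAGED STEP AT `(q, t) = (2, 3)` ON EVERY SIMPLE MATROID** — the body of `WeakAvgStepT α 2 3`
at a matroid without loops and without parallel pairs:
`Σ_{z ∈ E} 2 · #T_3(N ∖ z) + #E · thresholdSum N 2 3 ≤ Σ_{z ∈ E} thresholdSum (N ∖ z) 2 3 + #E · 2 · #T_3(N)`,
i.e. `Σ_z Φ_3(N ∖ z) ≤ #E · Φ_3(N)`.  The first proved instance of the averaged step of the threshold family. -/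
theorem weakAvg_two_three_of_simple (hloop : ∀ x ∈ gr N, rk N {x} = 1)
    (hpar : ∀ x ∈ gr N, ∀ y ∈ gr N, x ≠ y → rk N {x, y} ≠ 1) :
    ∑ z ∈ gr N, 2 * (levelSetCoQ (N ＼ ({z} : Set α)) 3 2).card + (gr N).card * thresholdSum N 2 3 ≤
      ∑ z ∈ gr N, thresholdSum (N ＼ ({z} : Set α)) 2 3 + (gr N).card * (2 * (levelSetCoQ N 3 2).card) := by
  -- the supply side: the deletion count of `T_3` with the lost sets
  have hS := sum_card_levelSetCoQ_three_delete_add_le (M := N) 2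
  have hT2 : 2 * (levelSetCoQ N 3 2).card ≤ ∑ S ∈ levelSetCoQ N 3 2, S.card := by
    rw [mul_comm, ← smul_eq_mul, ← sum_const]
    apply sum_le_sum
    intro S hS
    rw [mem_levelSetCoQ] at hS
    have h := rk_le_card (M := N) S
    rw [rk_eq_of_eRk_eq_cq hS.1.2] at h
    exact h
  -- the demand side, point by point
  have hper : ∀ B ∈ Rq N (2 - 1),
      (gr N).card * (if 3 + 1 ≤ rk N (gr N \ B) then rk N (gr N \ B) else 0) ≤
        (∑ z ∈ gr N \ B, (if 3 + 1 ≤ rk N ((gr N \ B).erase z) then rk N ((gr N \ B).erase z) else 0)) +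
          ((if 3 + 1 ≤ rk N (gr N \ B) then 2 * ((gr N).card - 1) else 0) +
            (if rk N (gr N \ B) = 4 then
              (coloops N (gr N \ B)).card * ((coloops N (gr N \ B)).card - 1) else 0)) := by
    intro B hB
    obtain ⟨b, hb, rfl⟩ := eq_singleton_of_mem_Rq_one hloop hpar hB
    set X := gr N \ {b} with hXdef
    have hX : X ⊆ gr N := sdiff_subset
    have hXc : X.card = (gr N).card - 1 := by
      rw [hXdef, card_sdiff_of_subset (singleton_subset_iff.2 hb), card_singleton]
    have hn1 : 1 ≤ (gr N).card := card_pos.2 ⟨b, hb⟩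
    have hnX : (gr N).card = X.card + 1 := by omega
    rw [sum_threshold_erase hX 3]
    have hmx : rk N X ≤ X.card := rk_le_card X
    have hkx : (coloops N X).card ≤ X.card := card_le_card (coloops_subset X)
    have h4 : rk N X = 4 → (coloops N X).card = 4 ∨ 5 ≤ X.card := by
      intro h4
      by_cases h5 : 5 ≤ X.card
      · exact Or.inr h5
      · left
        have hXc4 : X.card = 4 := by omega
        have hK : X ⊆ coloops N X := by
          intro z hz
          apply mem_coloops_of_rk_erase hX hz
          have h1 := rk_le_card (M := N) (X.erase z)
          rw [card_erase_of_mem hz, hXc4] at h1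
          have h2 := rk_le_rk_erase_add_one hX hz
          omega
        have := card_le_card hK
        omega
    have hari := weakAvg_point_arith X.card (rk N X) (coloops N X).card hmx hkx h4
    rw [hnX, Nat.add_sub_cancel]
    exact hari
  -- the per-point bounds, summed
  have hsum : (gr N).card * thresholdSum N 2 3 ≤
      ∑ z ∈ gr N, thresholdSum (N ＼ ({z} : Set α)) 2 3 +
        (((Rq N (2 - 1)).filter (fun B => 3 + 1 ≤ rk N (gr N \ B))).card * (2 * ((gr N).card - 1)) +
          ∑ B ∈ (Rq N (2 - 1)).filter (fun B => rk N (gr N \ B) = 4),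
            (coloops N (gr N \ B)).card * ((coloops N (gr N \ B)).card - 1)) := by
    rw [sum_thresholdSum_delete_eq]
    unfold thresholdSum
    rw [mul_sum]
    refine (sum_le_sum hper).trans ?_
    rw [sum_add_distrib, sum_add_distrib, ← sum_filter, ← sum_filter, sum_const, smul_eq_mul]
  -- the two charging bounds (A) and (B)
  have hA := card_filter_mul_le_two_mul_card_levelSetCoQ hloop hpar 3
  have hB := sum_card_coloops_mul_pred_le hloop hpar
  have hA2 : ((Rq N (2 - 1)).filter (fun B => 3 + 1 ≤ rk N (gr N \ B))).card * (2 * ((gr N).card - 1)) ≤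
      4 * (levelSetCoQ N 3 2).card := by
    rw [Nat.mul_left_comm _ 2]
    omega
  rw [← mul_sum, Nat.mul_left_comm (gr N).card 2]
  omega

/-- **The deletion rule at `(2, 3)` on every simple matroid**: some point is deletion-monotone
(`Φ_3(N ∖ z) ≤ Φ_3(N)`) — pigeonhole on the averaged step. -/
theorem exists_delMonoT_two_three_of_simple (hloop : ∀ x ∈ gr N, rk N {x} = 1)
    (hpar : ∀ x ∈ gr N, ∀ y ∈ gr N, x ≠ y → rk N {x, y} ≠ 1) (hne : (gr N).Nonempty) :
    ∃ z ∈ gr N, DelMonoT N z 2 3 :=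
  exists_delMonoT_of_weakAvg hne (weakAvg_two_three_of_simple hloop hpar)

end Main

end PercRepro.Cogirth
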